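import Literature.Geometry.Lorentzian.MetricFlattening
import Literature.Geometry.Lorentzian.VolumeChartIntegral
import Mathlib.MeasureTheory.Function.Jacobian
import HarnessLib

/-!
# Integration over a region where the metric is Euclidean in a chart of the maximal atlas

Let `h` be a smooth Riemannian metric on `N` (modelled on `ℝⁿ`), `e` a chart of the MAXIMAL atlas
and `B ⊆ e.target` an open set on which `h = e^*δ` (the output of `MetricFlattening.lean`). For a
function `F` supported in `e⁻¹(B)`, with `e⁻¹(B)` inside the domain of the atlas chart `φ` at a
point `p`,

  `∫_N F dμ_h = ∫_B F(e⁻¹ z) dz`                                  (`integral_eq_integral_flatChart`)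

— the chart formula for `φ` (`integral_eq_integral_chart`: `dμ_h = √det h_{ij} dy`, Chavel 2006,
(III.3.6)) followed by the change of variables `z = τ(y)`, `τ = e ∘ φ⁻¹` (Mathlib's
`integral_image_eq_integral_abs_det_fderiv_smul`), using that on the flat region the Gram matrix
of `φ` is `Dτᵀ Dτ`, so `√det h_{ij} = |det Dτ|` (`det_gram_fderiv_eq_sq`). Also: the smooth cutoff
`chartCutoff e φ̂` transported from the chart (`contMDiff_chartCutoff`). Everything is proved; the
only definition is the explicit cutoff `chartCutoff`.

## References

* I. Chavel, *Riemannian Geometry: A Modern Introduction*, 2nd ed., CUP 2006, §III.3 (III.3.6).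
  [Chavel2006]
* S.-S. Chern, *A simple intrinsic proof of the Gauss–Bonnet formula…*, Ann. of Math. 45 (1944),
  §2. [Chern1944]
-/

noncomputable section

set_option maxSynthPendingDepth 3

open Bundle Set Function Filter Module TopologicalSpace MeasureTheory Manifold
open scoped Manifold ContDiff Topology RealInnerProductSpace

namespace Literature.Geometry.Lorentzian

open Literature.Geometry.Riemannian

/-! ### Cutoffs transported from a chart of the maximal atlas -/

section Cutoff

variable {E : Type*} [NormedAddCommGroup E] [NormedSpace ℝ E] {H : Type*} [TopologicalSpace H]
  {I : ModelWithCorners ℝ E H} {M : Type*} [TopologicalSpace M]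

open Classical in
/-- A function on the chart target transported to the manifold by a chart and extended by zero:
`chartCutoff e φ̂ x = φ̂ (e x)` on `e.source`, `0` elsewhere. [folklore] -/
def chartCutoff (e : OpenPartialHomeomorph M H) (φ : H → ℝ) (x : M) : ℝ :=
  if x ∈ e.source then φ (e x) else 0

/-- On the chart source the transported cutoff is `φ̂ ∘ e`. [folklore] -/
theorem chartCutoff_of_mem {e : OpenPartialHomeomorph M H} {φ : H → ℝ} {x : M} (hx : x ∈ e.source) :
    chartCutoff e φ x = φ (e x) := by
  simp [chartCutoff, hx]

/-- Off the chart source the transported cutoff vanishes. [folklore] -/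
theorem chartCutoff_of_notMem {e : OpenPartialHomeomorph M H} {φ : H → ℝ} {x : M} (hx : x ∉ e.source) :
    chartCutoff e φ x = 0 := by
  simp [chartCutoff, hx]

/-- `chartCutoff e φ̂ (e⁻¹ y) = φ̂ y` on the target. [folklore] -/
theorem chartCutoff_symm {e : OpenPartialHomeomorph M H} {φ : H → ℝ} {y : H} (hy : y ∈ e.target) :
    chartCutoff e φ (e.symm y) = φ y := by
  rw [chartCutoff_of_mem (e.map_target hy), e.right_inv hy]

/-- The support of the transported cutoff lies in `e⁻¹(tsupport φ̂)`. [folklore] -/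
theorem support_chartCutoff_subset {e : OpenPartialHomeomorph M H} {φ : H → ℝ} :
    support (chartCutoff e φ) ⊆ e.symm '' tsupport φ := by
  intro x hx
  rw [mem_support] at hx
  by_cases hxs : x ∈ e.source
  · rw [chartCutoff_of_mem hxs] at hx
    exact ⟨e x, subset_tsupport _ (mem_support.2 hx), e.left_inv hxs⟩
  · exact absurd (chartCutoff_of_notMem hxs) hx

/-- The transported cutoff of a function with compact support in the target has compact support
`⊆ e⁻¹(tsupport φ̂) ⊆ e.source`. [folklore] -/
theorem tsupport_chartCutoff_subset [T2Space M] {e : OpenPartialHomeomorph M H} {φ : H → ℝ}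
    (hK : IsCompact (tsupport φ)) (hφ : tsupport φ ⊆ e.target) :
    tsupport (chartCutoff e φ) ⊆ e.symm '' tsupport φ := by
  have hc : IsCompact (e.symm '' tsupport φ) := hK.image_of_continuousOn (e.continuousOn_symm.mono hφ)
  exact closure_minimal (support_chartCutoff_subset) hc.isClosed

/-- The transported cutoff has compact support. [folklore] -/
theorem hasCompactSupport_chartCutoff [T2Space M] {e : OpenPartialHomeomorph M H} {φ : H → ℝ}
    (hK : IsCompact (tsupport φ)) (hφ : tsupport φ ⊆ e.target) :
    HasCompactSupport (chartCutoff e φ) :=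
  (hK.image_of_continuousOn (e.continuousOn_symm.mono hφ)).of_isClosed_subset
    (isClosed_tsupport _) (tsupport_chartCutoff_subset hK hφ)

/-- **The transported cutoff is smooth**: on `e.source` it is `φ̂ ∘ e` (`e` is `C^∞` there, being in
the maximal atlas), and every point off `e.source` has a neighbourhood missing the compact set
`e⁻¹(tsupport φ̂)`, on which it vanishes. [folklore] -/
theorem contMDiff_chartCutoff [ChartedSpace H M] [T2Space M] {n : ℕ∞ω} [IsManifold I n M] {e : OpenPartialHomeomorph M H}
    (he : e ∈ IsManifold.maximalAtlas I n M) {φ : H → ℝ} (hφs : ContMDiff I 𝓘(ℝ, ℝ) n φ)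
    (hK : IsCompact (tsupport φ)) (hφ : tsupport φ ⊆ e.target) :
    ContMDiff I 𝓘(ℝ, ℝ) n (chartCutoff e φ) := by
  intro x
  by_cases hx : x ∈ e.source
  · have hev : chartCutoff e φ =ᶠ[𝓝 x] fun y ↦ φ (e y) := by
      filter_upwards [e.open_source.mem_nhds hx] with y hy using chartCutoff_of_mem hy
    refine ContMDiffAt.congr_of_eventuallyEq ?_ hev
    exact (hφs _).comp x ((contMDiffOn_of_mem_maximalAtlas he).contMDiffAt (e.open_source.mem_nhds hx))
  · have hK' : IsCompact (e.symm '' tsupport φ) :=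
      hK.image_of_continuousOn (e.continuousOn_symm.mono hφ)
    have hxK : x ∉ e.symm '' tsupport φ := fun ⟨y, hy, hyx⟩ ↦ hx (hyx ▸ e.map_target (hφ hy))
    have hev : chartCutoff e φ =ᶠ[𝓝 x] fun _ ↦ 0 := by
      filter_upwards [hK'.isClosed.isOpen_compl.mem_nhds hxK] with y hy
      exact notMem_support.1 fun h ↦ hy (support_chartCutoff_subset h)
    exact contMDiffAt_const.congr_of_eventuallyEq hev

end Cutoff

/-! ### The Gram determinant of a linear map of Euclidean space -/

section Gram

variable {n : ℕ}

/-- **`det (⟪A eᵢ, A eⱼ⟫)ᵢⱼ = (det A)²`** for an endomorphism of `ℝⁿ` (the Gram matrix of the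
images of the standard basis is `Mᵀ M`, `M` the matrix of `A`). [folklore] -/
theorem det_gram_eq_sq (A : EuclideanSpace ℝ (Fin n) →L[ℝ] EuclideanSpace ℝ (Fin n)) :
    (Matrix.of fun i j : Fin n ↦
        ⟪A (EuclideanSpace.single i 1), A (EuclideanSpace.single j 1)⟫).det = A.det ^ 2 := by
  classical
  set b := (EuclideanSpace.basisFun (Fin n) ℝ).toBasis with hb
  set M : Matrix (Fin n) (Fin n) ℝ := LinearMap.toMatrix b b (A : EuclideanSpace ℝ (Fin n) →ₗ[ℝ] _)
    with hM
  have hMapply : ∀ k i, M k i = (A (EuclideanSpace.single i 1)) k := by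
    intro k i
    rw [hM, LinearMap.toMatrix_apply, hb, OrthonormalBasis.coe_toBasis, EuclideanSpace.basisFun_apply,
      OrthonormalBasis.coe_toBasis_repr_apply, EuclideanSpace.basisFun_repr]
    rfl
  have hgram : (Matrix.of fun i j : Fin n ↦
      ⟪A (EuclideanSpace.single i 1), A (EuclideanSpace.single j 1)⟫) = M.transpose * M := by
    ext i j
    rw [Matrix.of_apply, Matrix.mul_apply, PiLp.inner_apply]
    refine Finset.sum_congr rfl fun k _ ↦ ?_
    rw [Matrix.transpose_apply, hMapply, hMapply, real_inner_eq_re_inner, RCLike.inner_apply]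
    simp [mul_comm]
  rw [hgram, Matrix.det_mul, Matrix.det_transpose, hM, LinearMap.det_toMatrix, sq]

end Gram

/-! ### The chart formula in a flat chart of the maximal atlas -/

section FlatChart

variable {n : ℕ} {N : Type*} [TopologicalSpace N] [ChartedSpace (EuclideanSpace ℝ (Fin n)) N]
  [IsManifold 𝓘(ℝ, EuclideanSpace ℝ (Fin n)) ∞ N] [T3Space N] [MeasurableSpace N] [BorelSpace N]
  (h : ContMDiffRiemannianMetric 𝓘(ℝ, EuclideanSpace ℝ (Fin n)) ∞ (EuclideanSpace ℝ (Fin n))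
    (TangentSpace 𝓘(ℝ, EuclideanSpace ℝ (Fin n)) : N → Type _))
  {e : OpenPartialHomeomorph N (EuclideanSpace ℝ (Fin n))}
  (he : e ∈ IsManifold.maximalAtlas 𝓘(ℝ, EuclideanSpace ℝ (Fin n)) ∞ N) (p : N)
  {B : Set (EuclideanSpace ℝ (Fin n))} (hBo : IsOpen B) (hBe : B ⊆ e.target)
  (hBc : e.symm '' B ⊆ (chartAt (EuclideanSpace ℝ (Fin n)) p).source)
  (hflat : ∀ z ∈ B, ∀ v w,
    h.inner (e.symm z) v w = (euclideanMetric (EuclideanSpace ℝ (Fin n))).val z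
      (mfderiv 𝓘(ℝ, EuclideanSpace ℝ (Fin n)) 𝓘(ℝ, EuclideanSpace ℝ (Fin n)) e (e.symm z) v)
      (mfderiv 𝓘(ℝ, EuclideanSpace ℝ (Fin n)) 𝓘(ℝ, EuclideanSpace ℝ (Fin n)) e (e.symm z) w))

include he hflat in
omit [T3Space N] [MeasurableSpace N] [BorelSpace N] in
/-- **On the flat region the Gram matrix of the atlas chart is `Dτᵀ Dτ`, `τ = e ∘ φ⁻¹`**, hence
`√det h_{ij}(y) = |det Dτ(y)|`. [cite: Chavel2006, §III.3 (III.3.6)] -/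
theorem sqrt_det_chartGramMatrix_of_flatOn {y : EuclideanSpace ℝ (Fin n)}
    (hy : y ∈ (extChartAt 𝓘(ℝ, EuclideanSpace ℝ (Fin n)) p).target)
    (hye : (extChartAt 𝓘(ℝ, EuclideanSpace ℝ (Fin n)) p).symm y ∈ e.source)
    (hyB : e ((extChartAt 𝓘(ℝ, EuclideanSpace ℝ (Fin n)) p).symm y) ∈ B) :
    haveI : IsManifold 𝓘(ℝ, EuclideanSpace ℝ (Fin n)) 1 N := IsManifold.of_le (n := ∞)
      (WithTop.coe_le_coe.mpr le_top)
    Real.sqrt (chartGramMatrix h p y).det =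
      |(fderiv ℝ (e ∘ (extChartAt 𝓘(ℝ, EuclideanSpace ℝ (Fin n)) p).symm) y).det| := by
  haveI : IsManifold 𝓘(ℝ, EuclideanSpace ℝ (Fin n)) 1 N := IsManifold.of_le (n := ∞)
    (WithTop.coe_le_coe.mpr le_top)
  set c := extChartAt 𝓘(ℝ, EuclideanSpace ℝ (Fin n)) p with hc
  set x := c.symm y with hx
  have hxs : x ∈ (chartAt (EuclideanSpace ℝ (Fin n)) p).source := by
    rw [← extChartAt_source 𝓘(ℝ, EuclideanSpace ℝ (Fin n))]
    exact c.map_target hy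
  have hcx : c x = y := c.right_inv hy
  -- `τ` is differentiable at `y`
  have hτd : DifferentiableAt ℝ (e ∘ c.symm) y := by
    have h1 : ContMDiffAt 𝓘(ℝ, EuclideanSpace ℝ (Fin n)) 𝓘(ℝ, EuclideanSpace ℝ (Fin n)) ∞ c.symm y :=
      (contMDiffOn_extChartAt_symm p).contMDiffAt ((isOpen_extChartAt_target p).mem_nhds hy)
    have h2 : ContMDiffAt 𝓘(ℝ, EuclideanSpace ℝ (Fin n)) 𝓘(ℝ, EuclideanSpace ℝ (Fin n)) ∞ e x :=
      (contMDiffOn_of_mem_maximalAtlas he).contMDiffAt (e.open_source.mem_nhds hye)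
    have h3 := h2.comp y h1
    exact (contMDiffAt_iff_contDiffAt.1 h3).differentiableAt (by simp)
  -- the entries of the Gram matrix
  have hz : e x = e x := rfl
  have hentry : ∀ i j, chartGramMatrix h p y i j =
      ⟪fderiv ℝ (e ∘ c.symm) y (EuclideanSpace.single i 1),
        fderiv ℝ (e ∘ c.symm) y (EuclideanSpace.single j 1)⟫ := by
    intro i j
    have hsymmL : ∀ v : EuclideanSpace ℝ (Fin n),
        mfderivWithin 𝓘(ℝ, EuclideanSpace ℝ (Fin n)) 𝓘(ℝ, EuclideanSpace ℝ (Fin n)) c.symm (range 𝓘(ℝ, EuclideanSpace ℝ (Fin n))) y v =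
        (trivializationAt (EuclideanSpace ℝ (Fin n)) (TangentSpace 𝓘(ℝ, EuclideanSpace ℝ (Fin n)) : N → Type _) p).symmL ℝ x v := by
      intro v
      rw [TangentBundle.symmL_trivializationAt hxs, hcx]
      rfl
    have hB' : e x ∈ B := hyB
    have hsymm : e.symm (e x) = x := e.left_inv hye
    have hfl := hflat (e x) hB'
    rw [hsymm] at hfl
    simp only [chartGramMatrix, Matrix.of_apply]
    rw [hsymmL, hsymmL, hfl]
    have key := flatBilin_symmL_symmL he p hy hye hτd
      (EuclideanSpace.single i 1) (EuclideanSpace.single j 1)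
    rw [flatBilin_apply] at key
    rw [key, ContinuousLinearMap.bilinearComp_apply, innerSL_apply_apply]
  have hmat : chartGramMatrix h p y = Matrix.of fun i j : Fin n ↦
      ⟪fderiv ℝ (e ∘ c.symm) y (EuclideanSpace.single i 1),
        fderiv ℝ (e ∘ c.symm) y (EuclideanSpace.single j 1)⟫ := by
    ext i j
    rw [hentry, Matrix.of_apply]
  rw [hmat, det_gram_eq_sq, Real.sqrt_sq_eq_abs]

include he hBo hBe hBc hflat in
/-- **The Riemannian integral of a function supported in a flat chart region is the Lebesgue
integral of its representative**: `∫_N F dμ_h = ∫_B F(e⁻¹ z) dz` for `F` measurable with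
`support F ⊆ e⁻¹(B)`, `h = e^*δ` on `B`, and `e⁻¹(B)` inside the atlas chart domain at `p` (chart
formula `dμ_h = √det h_{ij} dy`, Chavel 2006, (III.3.6), and the change of variables `z = e(φ⁻¹ y)`,
whose Jacobian is `√det h_{ij}` by `sqrt_det_chartGramMatrix_of_flatOn`).
[cite: Chavel2006, §III.3 (III.3.6)] -/
theorem integral_eq_integral_flatChart {F : N → ℝ} (hFm : Measurable F)
    (hsupp : support F ⊆ e.symm '' B) :
    ∫ x, F x ∂riemannianMeasure h = ∫ z in B, F (e.symm z) := by
  haveI : IsManifold 𝓘(ℝ, EuclideanSpace ℝ (Fin n)) 1 N := IsManifold.of_le (n := ∞)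
    (WithTop.coe_le_coe.mpr le_top)
  set c := extChartAt 𝓘(ℝ, EuclideanSpace ℝ (Fin n)) p with hc
  have hcs : c.source = (chartAt (EuclideanSpace ℝ (Fin n)) p).source := extChartAt_source _ p
  have himg : e.symm '' B = e.source ∩ e ⁻¹' B := e.symm_image_eq_source_inter_preimage hBe
  have hF_src : support F ⊆ c.source := hsupp.trans (hcs ▸ hBc)
  -- the chart formula for the atlas chart at `p`
  rw [integral_eq_integral_chart h p hFm hF_src]
  -- the region `s` of the chart target mapped into `e⁻¹(B)`
  set s : Set (EuclideanSpace ℝ (Fin n)) := c.target ∩ c.symm ⁻¹' (e.source ∩ e ⁻¹' B) with hs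
  have hso : IsOpen s :=
    (continuousOn_extChartAt_symm p).isOpen_inter_preimage (isOpen_extChartAt_target p)
      (e.isOpen_inter_preimage hBo)
  have hsm : MeasurableSet s := hso.measurableSet
  have hst : s ⊆ c.target := inter_subset_left
  -- off `s` the integrand vanishes
  have h1 : ∫ y in c.target, Real.sqrt (chartGramMatrix h p y).det • F (c.symm y) =
      ∫ y in s, Real.sqrt (chartGramMatrix h p y).det • F (c.symm y) := by
    refine setIntegral_eq_of_subset_of_forall_sdiff_eq_zero (isOpen_extChartAt_target p).measurableSet
      hst fun y hy ↦ ?_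
    have hy0 : F (c.symm y) = 0 := by
      by_contra hne
      have hmem : c.symm y ∈ e.source ∩ e ⁻¹' B := himg ▸ hsupp (mem_support.2 hne)
      exact hy.2 ⟨hy.1, hmem⟩
    rw [hy0, smul_zero]
  rw [h1]
  -- the map `τ = e ∘ φ⁻¹` on `s`
  set τ : EuclideanSpace ℝ (Fin n) → EuclideanSpace ℝ (Fin n) := e ∘ c.symm with hτ
  have hτd : ∀ y ∈ s, DifferentiableAt ℝ τ y := by
    intro y hy
    have h1 : ContMDiffAt 𝓘(ℝ, EuclideanSpace ℝ (Fin n)) 𝓘(ℝ, EuclideanSpace ℝ (Fin n)) ∞ c.symm y :=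
      (contMDiffOn_extChartAt_symm p).contMDiffAt ((isOpen_extChartAt_target p).mem_nhds hy.1)
    have h2 : ContMDiffAt 𝓘(ℝ, EuclideanSpace ℝ (Fin n)) 𝓘(ℝ, EuclideanSpace ℝ (Fin n)) ∞ e (c.symm y) :=
      (contMDiffOn_of_mem_maximalAtlas he).contMDiffAt (e.open_source.mem_nhds hy.2.1)
    exact (contMDiffAt_iff_contDiffAt.1 (h2.comp y h1)).differentiableAt (by simp)
  have hτ' : ∀ y ∈ s, HasFDerivWithinAt τ (fderiv ℝ τ y) s y := fun y hy ↦
    (hτd y hy).hasFDerivAt.hasFDerivWithinAt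
  have hinj : InjOn τ s := by
    intro y₁ hy₁ y₂ hy₂ hτy
    have h1 : c.symm y₁ = c.symm y₂ := e.injOn hy₁.2.1 hy₂.2.1 hτy
    rw [← c.right_inv hy₁.1, ← c.right_inv hy₂.1, h1]
  have himage : τ '' s = B := by
    apply Subset.antisymm
    · rintro _ ⟨y, hy, rfl⟩
      exact hy.2.2
    · intro z hz
      have hxs : e.symm z ∈ c.source := hcs ▸ hBc ⟨z, hz, rfl⟩
      refine ⟨c (e.symm z), ⟨c.map_source hxs, ?_⟩, ?_⟩
      · show c.symm (c (e.symm z)) ∈ e.source ∩ e ⁻¹' B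
        rw [c.left_inv hxs]
        exact ⟨e.map_target (hBe hz), by show e (e.symm z) ∈ B; rwa [e.right_inv (hBe hz)]⟩
      · show e (c.symm (c (e.symm z))) = z
        rw [c.left_inv hxs, e.right_inv (hBe hz)]
  -- rewrite the integrand on `s` and change variables
  have h2 : ∫ y in s, Real.sqrt (chartGramMatrix h p y).det • F (c.symm y) =
      ∫ y in s, |(fderiv ℝ τ y).det| • (F ∘ e.symm) (τ y) := by
    refine setIntegral_congr_fun hsm fun y hy ↦ ?_
    have hcalc := sqrt_det_chartGramMatrix_of_flatOn h he p hflat hy.1 hy.2.1 hy.2.2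
    rw [hcalc]
    simp only [hτ, Function.comp_apply, e.left_inv hy.2.1]
    rfl
  rw [h2, ← integral_image_eq_integral_abs_det_fderiv_smul volume hsm hτ' hinj (F ∘ e.symm), himage]
  rfl

end FlatChart

end Literature.Geometry.Lorentzian

end
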